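import Mathlib
import Summits.ValiantsHypothesis.ValiantsHypothesis.Theorems.GrenetZeonTwoDimCoefficientsScalingSquarefreeDescent
import Summits.ValiantsHypothesis.ValiantsHypothesis.Theorems.GrenetZeonTwoDimCoefficientsScalingIndexSquarefree
import Summits.ValiantsHypothesis.ValiantsHypothesis.Theorems.GrenetZeonTwoDimCoefficientsScalingRaySquarefree

/-!
# Crux `GrenetZeon.TwoDimCoefficients` (stmt-ValiantsHypothesis-8062), stub `stub_dualUnipotent`:
# scaling-closure — the 3/2 rung from a SQUAREFREE SHADOW `h₁(z) ∈ ℂ[z]` (residual R9″ closed)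

With the quasi-homogeneous descent ✓ `squarefree_map_fractionRing_of_quasiHomogeneous` (file
`…ScalingSquarefreeDescent`) the function-field certificate of the 17th hand's conditional 3/2 rung becomes a statement
about an honest polynomial in `z` — the scaling-closure SHADOW at `t = 1`:

* ★★ `cube_le_two_mul_sq_of_index_shadowSquarefree` — INDEX-`n` unipotent dual representation of `per_n`
  (`A = A₀(1 − N)`, `Nⁿ = 0`, `det A = c ≠ 0`, `per_n = α·c + β·tr(adj A·B)`, wild pencils allowed, `n ≥ 3`, `m ≥ 2`)
  whose shadow `det(1_m + c⁻¹·P^top) ∈ ℂ[z]` (`P^top` = degree-`n` part of `adj A·B`; by ✓ `shadow_eq_det` this is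
  `c⁻¹·Σ_k [D_k]_{kn}`) is SQUAREFREE AS A POLYNOMIAL IN `z` ⟹ `n³ ≤ 2m²` (crux `DualUnipotentThreeHalves`' bound,
  constant `2`).
* ★★ `cube_le_two_mul_sq_of_ray_shadowSquarefree` — hdeg pencil (`deg D_k ≤ kn`) with top companion order `J`: the
  shadow `c + Σ_{k ≤ J} [D_k]_{kn} ∈ ℂ[z]` squarefree ⟹ `n³ ≤ 2m²`.

So the exact residual of the scaling-closure method on index-`n` pencils is: shadows `det(1_m + c⁻¹P^top)` with a
REPEATED FACTOR in `ℂ[z]` (lemma L1′ of memo SEVENTEENTH-HAND.md: Mignon–Ressayre for multiple shadow factors).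

HONEST FRAMING: a certificate simplification for a conditional rung; the stub `DualUnipotentBound`, both cruxes
(stmt-8062, stmt-24318) and `VP ≠ VNP` remain open.

References: T. Mignon, N. Ressayre, Int. Math. Res. Not. 2004:79, Thm. 1.1 (via the tree); folklore.
-/

-- single-conjunct layout `Summits/ValiantsHypothesis/ValiantsHypothesis`: the duplicated namespace
-- component is mandated by the tree.
set_option linter.dupNamespace false
set_option autoImplicit false

noncomputable section

namespace Summit.ValiantsHypothesis.ValiantsHypothesis.Theorems.GrenetZeonTwoDimCoefficients.ScalingClosure

open MvPolynomial Matrix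
open Literature.Computability.AlgebraicComplexity
open Summit.ValiantsHypothesis.ValiantsHypothesis.Cruxes.TwoDimCoefficients.DimTwoCases

section Rungs

/-- ★★ **Index-`n` pencils with squarefree SHADOW `det(1_m + c⁻¹·P^top) ∈ ℂ[z]` obey `n³ ≤ 2m²`** (`n = k + 3`,
`m ≥ 2`): ✓ `cube_le_two_mul_sq_of_index_squarefree` with the function-field certificate replaced by squarefreeness
of an honest polynomial in `z` (quasi-homogeneous descent). [cite: MignonRessayre2004, Thm. 1.1 — via the tree; folklore] -/
theorem cube_le_two_mul_sq_of_index_shadowSquarefree {k m : ℕ} (A B : AffMat (k + 3) m) (hA : IsAffine A)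
    (hB : IsAffine B) (α β c : ℂ) (hc : c ≠ 0) (hβ : β ≠ 0) (hdet : A.det = MvPolynomial.C c)
    (hper : perPoly (Fin (k + 3)) ℂ =
      MvPolynomial.C α * A.det + MvPolynomial.C β * (A.adjugate * B).trace)
    (hm2 : 2 ≤ m) (A₀ P₀ : Matrix (Fin m) (Fin m) ℂ) (hP₀ : A₀ * P₀ = 1) (N : AffMat (k + 3) m)
    (hN : ∀ i j, (N i j).IsHomogeneous 1) (hNn : N ^ (k + 3) = 0) (hAN : A = A₀.map MvPolynomial.C * (1 - N))
    (Ptop : AffMat (k + 3) m) (htop : ∀ i j, Ptop i j = homogeneousComponent (k + 3) ((A.adjugate * B) i j))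
    (hsq : Squarefree
      ((1 + (MvPolynomial.C c⁻¹ : MvPolynomial (Fin (k + 3) × Fin (k + 3)) ℂ) • Ptop).det)) :
    (k + 3) ^ 3 ≤ 2 * m ^ 2 := by
  set Mtop : AffMat (k + 3) m := -((MvPolynomial.C c⁻¹ : MvPolynomial (Fin (k + 3) × Fin (k + 3)) ℂ) • Ptop)
    with hMtop
  have hMhom : ∀ i j, (Mtop i j).IsHomogeneous (k + 3) := fun i j => by
    rw [hMtop, Matrix.neg_apply, Matrix.smul_apply, smul_eq_mul]
    have h := homogeneousComponent_isHomogeneous (k + 3) ((A.adjugate * B) i j)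
    rw [← htop i j] at h
    exact (h.C_mul _).neg
  have hQH := isQuasiHomogeneous_charpolyRev Mtop hMhom
  have hR0 : Mtop.charpolyRev.coeff 0 = MvPolynomial.C 1 := by
    rw [Polynomial.coeff_zero_eq_eval_zero, Matrix.eval_charpolyRev, map_one]
  have hev : Mtop.charpolyRev.eval 1 =
      (1 + (MvPolynomial.C c⁻¹ : MvPolynomial (Fin (k + 3) × Fin (k + 3)) ℂ) • Ptop).det := by
    rw [eval_one_charpolyRev, hMtop, sub_neg_eq_add]
  have hmain := squarefree_map_fractionRing_of_quasiHomogeneous (n := k + 3) (by omega) Mtop.charpolyRev 1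
    one_ne_zero hQH hR0 (hev ▸ hsq)
  refine cube_le_two_mul_sq_of_index_squarefree A B hA hB α β c hc hβ hdet hper hm2 A₀ P₀ hP₀ N hN hNn hAN
    Ptop htop ?_
  rw [Polynomial.map_mul, Polynomial.map_C]
  have hu : IsUnit (Polynomial.C (algebraMap (MvPolynomial (Fin (k + 3) × Fin (k + 3)) ℂ)
      (FractionRing (MvPolynomial (Fin (k + 3) × Fin (k + 3)) ℂ)) (MvPolynomial.C c))) := by
    refine Polynomial.isUnit_C.mpr (IsUnit.mk0 _ fun h => ?_)
    have h' : (MvPolynomial.C c : MvPolynomial (Fin (k + 3) × Fin (k + 3)) ℂ) = 0 :=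
      (map_eq_zero_iff _ (IsFractionRing.injective (MvPolynomial (Fin (k + 3) × Fin (k + 3)) ℂ)
        (FractionRing (MvPolynomial (Fin (k + 3) × Fin (k + 3)) ℂ)))).mp h
    exact hc ((map_eq_zero_iff _ (MvPolynomial.C_injective _ _)).mp h')
  exact hmain.squarefree_of_dvd ((hu.mul_left_dvd).mpr dvd_rfl)

/-- ★★ **hdeg pencils with squarefree SHADOW `c + Σ_{k ≤ J} [D_k]_{kn} ∈ ℂ[z]` obey `n³ ≤ 2m²`** (`n = k + 3`,
`m ≥ 2`): ✓ `cube_le_two_mul_sq_of_raySquarefree` with the function-field certificate replaced by squarefreeness of the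
scaling-closure shadow `h₁(z)` itself, an honest polynomial in `z`. [cite: MignonRessayre2004, Thm. 1.1 — via the tree; folklore] -/
theorem cube_le_two_mul_sq_of_ray_shadowSquarefree {k m : ℕ} (A B : AffMat (k + 3) m) (hA : IsAffine A)
    (hB : IsAffine B) (α β c : ℂ) (hc : c ≠ 0) (hβ : β ≠ 0) (hdet : A.det = MvPolynomial.C c)
    (hper : perPoly (Fin (k + 3)) ℂ =
      MvPolynomial.C α * A.det + MvPolynomial.C β * (A.adjugate * B).trace)
    (hm2 : 2 ≤ m) (D : ℕ → MvPolynomial (Fin (k + 3) × Fin (k + 3)) ℂ)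
    (hD : ∀ j, D j = (det ((Polynomial.X : Polynomial (MvPolynomial (Fin (k + 3) × Fin (k + 3)) ℂ)) •
      B.map Polynomial.C + A.map Polynomial.C)).coeff j)
    (hdeg : ∀ j, 2 ≤ j → ∀ d, j * (k + 3) < d → homogeneousComponent d (D j) = 0)
    {J : ℕ} (hJ1 : 1 ≤ J) (hJtop : homogeneousComponent (J * (k + 3)) (D J) ≠ 0)
    (hJ : ∀ j, J < j → j ≤ m → homogeneousComponent (j * (k + 3)) (D j) = 0)
    (hsq : Squarefree (MvPolynomial.C c +
      ∑ e : Fin J, homogeneousComponent (((e : ℕ) + 1) * (k + 3)) (D (e + 1)))) :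
    (k + 3) ^ 3 ≤ 2 * m ^ 2 := by
  set R : Polynomial (MvPolynomial (Fin (k + 3) × Fin (k + 3)) ℂ) :=
    Polynomial.C (MvPolynomial.C c) + ∑ e : Fin J,
      Polynomial.C (homogeneousComponent (((e : ℕ) + 1) * (k + 3)) (D (e + 1))) * Polynomial.X ^ ((e : ℕ) + 1)
    with hRdef
  have hQH : ∀ j, (R.coeff j).IsHomogeneous ((k + 3) * j) := by
    intro j
    rw [hRdef, Polynomial.coeff_add, Polynomial.coeff_C, Polynomial.finsetSum_coeff]
    refine IsHomogeneous.add ?_ (IsHomogeneous.sum _ _ _ fun e _ => ?_)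
    · split_ifs with hj
      · subst hj; rw [mul_zero]; exact isHomogeneous_C _ _
      · exact isHomogeneous_zero _ _ _
    · rw [Polynomial.coeff_C_mul_X_pow]
      split_ifs with hj
      · rw [hj, mul_comm]; exact homogeneousComponent_isHomogeneous _ _
      · exact isHomogeneous_zero _ _ _
  have hR0 : R.coeff 0 = MvPolynomial.C c := by
    rw [hRdef, Polynomial.coeff_add, Polynomial.coeff_C_zero, Polynomial.finsetSum_coeff]
    simp
  have hev : R.eval 1 = MvPolynomial.C c +
      ∑ e : Fin J, homogeneousComponent (((e : ℕ) + 1) * (k + 3)) (D (e + 1)) := by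
    rw [hRdef, Polynomial.eval_add, Polynomial.eval_C, Polynomial.eval_finsetSum]
    simp [Polynomial.eval_mul, Polynomial.eval_C, Polynomial.eval_pow, Polynomial.eval_X]
  have hmain := squarefree_map_fractionRing_of_quasiHomogeneous (n := k + 3) (by omega) R c hc hQH hR0
    (hev ▸ hsq)
  exact cube_le_two_mul_sq_of_raySquarefree A B hA hB α β c hc hβ hdet hper hm2 D hD hdeg hJ1 hJtop hJ hmain

end Rungs

end Summit.ValiantsHypothesis.ValiantsHypothesis.Theorems.GrenetZeonTwoDimCoefficients.ScalingClosure

end
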